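import Mathlib
import Summits.ValiantsHypothesis.ValiantsHypothesis.Theorems.FreeSubtorusSubtorusCoveringIndepMatchingIndependent
import Summits.ValiantsHypothesis.ValiantsHypothesis.Theorems.FreeSubtorusOrbitDimensionBoundStubAbsorbingSacrificeRematch
import HarnessLib

/-!
# Route FreeSubtorus — crux `OrbitDimensionBound` (stmt-ValiantsHypothesis-16133), line `affine_multiple`,
# stub 2 `stub_absorbingSacrifice`, step (3): the FINAL MATCHING — preliminaries

Registered skeleton `Cruxes/OrbitDimensionBound/Lines/affine_multiple.lean`, stub 2 (`Stmt.stub_absorbingSacrifice`, L,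
load-bearing).  The composition of stub 2 runs: maximum independent matching (`indepMatching_independent`) → CHOICE OF
THE FINAL MATCHING (extra pair / re-matching / rigid pin; this file and its sequel `…FinalMatching.lean`) → relabelling →
pinned terminal step.  Everything here is integer / rational linear algebra on the lattice datum
`Λ : Fin r → (Fin n ⊕ Fin n) → ℤ` (columns `a_k = Λ(·)(inl k)`, `b_l = Λ(·)(inr l)` in `ℚ^r`), a finite set `S` of
positions (the support of the linear cofactor `q`) and the INTEGER SEMI-INVARIANCE hypothesis `hSI` (every integer
relation `Σ x_k a_k + Σ y_l b_l = 0` gives all positions of `S` the same weight `x_{p.1} + y_{p.2}`; supplied by the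
forced semi-invariance of the cofactor, `cofactor_intWeights_eq`).

* `intExpansions_of_span` — the floor's denominator clearing, factored: if every difference `a_k − b_l` lies in the
  `ℚ`-span of the matched differences and the row-sums of `Λ` vanish, then for one `N > 0` every `N a_k`, `N b_l` is an
  INTEGER combination of the matched differences (coefficient functions `ar`, `ac`).
* `free_support_unique` — under `hSI` and such integer expansions, two positions of `S` that are both free (row not
  matched, column not matched) coincide (the relation `N a_k = Σ ar_kj (a_{ιj} − b_{κj})` has weight `N` at a free
  position in row `k` and weight `0` at any other free position).
* `update_injective_of_not_mem_range`, `self_not_mem_range_update`, `not_mem_range_update` — re-matching one pair of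
  an injective partial matching.
* `coeff_eq_of_sub_mem_span_ne` — if `u − v` lies in the span of the matched differences other than `j₀`, the
  `j₀`-coefficients of the integer expansions of `N u`, `N v` agree.
* `concl_of_free_or_diag` — the two EASY exits of the case analysis, packaged in the output format of the final
  matching (consumed by the relabelling / terminal step): an independent maximum matching with a support position on
  its diagonal is final (pin = that diagonal position); one with a FREE support position gets that position as ONE
  EXTRA PAIR (`t = s + 1 ≤ r + 1`), after which no free support remains (`free_support_unique`).

Honest framing: helper plumbing for a registered stub of an OPEN crux on a conditional route; nothing here bears on
`VP ≠ VNP` (NOT proved).  No definitions, no named facts.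
-/

-- the mandated summit-side namespace repeats a component by design (single-conjunct summit)
set_option linter.dupNamespace false

namespace Summit.ValiantsHypothesis.ValiantsHypothesis.Theorems.FreeSubtorusOrbitDimensionBound.AbsorbingSacrifice

open Finset Submodule
open Summit.ValiantsHypothesis.ValiantsHypothesis.Theorems.FreeSubtorusSubtorusCovering (indepMatching_span)

/-! ### Integer expansions with a common denominator -/

/-- **Denominator clearing** (the floor's `stub_indepMatching` tail, factored): zero row-sums and `ℚ`-spanning of all
differences by the matched differences give one `N > 0` and INTEGER expansions of every `N·Λ(·)(inl k)` and
`N·Λ(·)(inr l)`. [folklore] -/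
theorem intExpansions_of_span {n r s : ℕ} (Λ : Fin r → (Fin n ⊕ Fin n) → ℤ)
    (hrow : ∀ i, (∑ k, Λ i (Sum.inl k)) = 0) (hn : 0 < n) (ι κ : Fin s → Fin n)
    (hspan : ∀ k l, (fun i => (Λ i (Sum.inl k) : ℚ) - (Λ i (Sum.inr l) : ℚ)) ∈
      Submodule.span ℚ (Set.range fun (t : Fin s) (i : Fin r) =>
        (Λ i (Sum.inl (ι t)) : ℚ) - (Λ i (Sum.inr (κ t)) : ℚ))) :
    ∃ (N : ℕ) (ar ac : Fin n → Fin s → ℤ), 0 < N ∧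
      (∀ k i, (N : ℤ) * Λ i (Sum.inl k) =
        ∑ j, ar k j * (Λ i (Sum.inl (ι j)) - Λ i (Sum.inr (κ j)))) ∧
      (∀ l i, (N : ℤ) * Λ i (Sum.inr l) =
        ∑ j, ac l j * (Λ i (Sum.inl (ι j)) - Λ i (Sum.inr (κ j)))) := by
  classical
  let a : Fin n → (Fin r → ℚ) := fun k i => (Λ i (Sum.inl k) : ℚ)
  let b : Fin n → (Fin r → ℚ) := fun l i => (Λ i (Sum.inr l) : ℚ)
  set w : Fin s → (Fin r → ℚ) := fun t => a (ι t) - b (κ t) with hwdef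
  set S : Submodule ℚ (Fin r → ℚ) := span ℚ (Set.range w) with hS
  have hspan' : ∀ k l, a k - b l ∈ S := fun k l => hspan k l
  -- zero row-sums: every column lies in `S`
  have hn0 : (n : ℚ) ≠ 0 := by exact_mod_cast (Nat.pos_iff_ne_zero.1 hn)
  let l₀ : Fin n := ⟨0, hn⟩
  have hsum0 : ∑ k, a k = 0 := by
    funext i
    rw [Finset.sum_apply]
    simp only [a, Pi.zero_apply]
    exact_mod_cast hrow i
  have ha : ∀ k, a k ∈ S := by
    intro k
    have hsum : (n : ℚ) • a k = ∑ k', (a k - a k') := by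
      rw [Finset.sum_sub_distrib, hsum0, sub_zero, Finset.sum_const, card_univ, Fintype.card_fin,
        Nat.cast_smul_eq_nsmul]
    have hmem : (n : ℚ) • a k ∈ S := by
      rw [hsum]
      refine S.sum_mem fun k' _ => ?_
      have : a k - a k' = (a k - b l₀) - (a k' - b l₀) := by abel
      rw [this]
      exact S.sub_mem (hspan' k l₀) (hspan' k' l₀)
    have := S.smul_mem (n : ℚ)⁻¹ hmem
    rwa [smul_smul, inv_mul_cancel₀ hn0, one_smul] at this
  have hb : ∀ l, b l ∈ S := fun l => by
    have : b l = a l₀ - (a l₀ - b l) := by abel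
    rw [this]
    exact S.sub_mem (ha l₀) (hspan' l₀ l)
  -- coordinates and a common denominator
  have hcoef : ∀ x ∈ S, ∃ c : Fin s → ℚ, x = ∑ t, c t • w t := fun x hx => by
    obtain ⟨c, hc⟩ := (Submodule.mem_span_range_iff_exists_fun ℚ).1 hx
    exact ⟨c, hc.symm⟩
  choose ca hca using fun k => hcoef (a k) (ha k)
  choose cb hcb using fun l => hcoef (b l) (hb l)
  set N : ℕ := (∏ k, ∏ t, (ca k t).den) * ∏ l, ∏ t, (cb l t).den with hN
  have hNpos : 0 < N := by
    refine Nat.pos_of_ne_zero ?_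
    simp only [hN, mul_ne_zero_iff, Finset.prod_ne_zero_iff]
    exact ⟨fun k _ t _ => (ca k t).den_nz, fun l _ t _ => (cb l t).den_nz⟩
  -- evaluation of a coordinate expansion at `i`
  have heval : ∀ (x : Fin r → ℚ) (c : Fin s → ℚ), x = ∑ t, c t • w t → ∀ i,
      (N : ℚ) * x i = ∑ t, ((N : ℚ) * c t) *
        ((Λ i (Sum.inl (ι t)) : ℚ) - (Λ i (Sum.inr (κ t)) : ℚ)) := by
    intro x c hx i
    rw [hx, Finset.sum_apply, Finset.mul_sum]
    refine Finset.sum_congr rfl fun t _ => ?_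
    simp only [Pi.smul_apply, hwdef, Pi.sub_apply, smul_eq_mul, a, b]
    ring
  -- clearing one coordinate vector
  have hclear : ∀ c : Fin s → ℚ, (∀ t, (c t).den ∣ N) →
      ∃ z : Fin s → ℤ, ∀ t, ((z t : ℤ) : ℚ) = (N : ℚ) * c t := by
    intro c hc
    refine ⟨fun t => ((N / (c t).den : ℕ) : ℤ) * (c t).num, fun t => ?_⟩
    obtain ⟨m, hm⟩ := hc t
    have hden : (c t).den ≠ 0 := (c t).den_nz
    have hdiv : N / (c t).den = m := by
      rw [hm, Nat.mul_div_cancel_left _ (Nat.pos_of_ne_zero hden)]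
    dsimp only
    rw [hdiv]
    push_cast
    rw [hm]
    push_cast
    rw [← Rat.mul_den_eq_num (c t)]
    ring
  have hrowZ : ∀ k, ∃ z : Fin s → ℤ, ∀ i, (N : ℤ) * Λ i (Sum.inl k) =
      ∑ j, z j * (Λ i (Sum.inl (ι j)) - Λ i (Sum.inr (κ j))) := by
    intro k
    have hdvd : ∀ t, (ca k t).den ∣ N := fun t =>
      ((Finset.dvd_prod_of_mem (fun t => (ca k t).den) (mem_univ t)).trans
        (Finset.dvd_prod_of_mem (fun k => ∏ t, (ca k t).den) (mem_univ k))).mul_right _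
    obtain ⟨z, hz⟩ := hclear (ca k) hdvd
    refine ⟨z, fun i => ?_⟩
    have key := heval (a k) (ca k) (hca k) i
    have : ((((N : ℤ) * Λ i (Sum.inl k) : ℤ)) : ℚ) =
        ((∑ j, z j * (Λ i (Sum.inl (ι j)) - Λ i (Sum.inr (κ j))) : ℤ) : ℚ) := by
      push_cast
      rw [key]
      refine Finset.sum_congr rfl fun t _ => ?_
      rw [hz t]
    exact_mod_cast this
  have hcolZ : ∀ l, ∃ z : Fin s → ℤ, ∀ i, (N : ℤ) * Λ i (Sum.inr l) =
      ∑ j, z j * (Λ i (Sum.inl (ι j)) - Λ i (Sum.inr (κ j))) := by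
    intro l
    have hdvd : ∀ t, (cb l t).den ∣ N := fun t =>
      ((Finset.dvd_prod_of_mem (fun t => (cb l t).den) (mem_univ t)).trans
        (Finset.dvd_prod_of_mem (fun l => ∏ t, (cb l t).den) (mem_univ l))).mul_left _
    obtain ⟨z, hz⟩ := hclear (cb l) hdvd
    refine ⟨z, fun i => ?_⟩
    have key := heval (b l) (cb l) (hcb l) i
    have : ((((N : ℤ) * Λ i (Sum.inr l) : ℤ)) : ℚ) =
        ((∑ j, z j * (Λ i (Sum.inl (ι j)) - Λ i (Sum.inr (κ j))) : ℤ) : ℚ) := by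
      push_cast
      rw [key]
      refine Finset.sum_congr rfl fun t _ => ?_
      rw [hz t]
    exact_mod_cast this
  choose ar har using hrowZ
  choose ac hac using hcolZ
  exact ⟨N, ar, ac, hNpos, har, hac⟩

/-! ### Uniqueness of a free support position -/

/-- **Two free support positions coincide.**  Under the integer semi-invariance `hSI` of the support `S` and
integer expansions of all columns of `Λ` through the matched differences (`N > 0`), two positions of `S` whose rows
and columns are both unmatched are equal: the expansion of `N a_{p₁.1}` is an integer relation of weight `N` at `p₁`
and weight `N·[p₂.1 = p₁.1]` at `p₂` (and symmetrically for the columns). [folklore] -/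
theorem free_support_unique {n r s : ℕ} (Λ : Fin r → (Fin n ⊕ Fin n) → ℤ) (S : Finset (Fin n × Fin n))
    (hSI : ∀ x y : Fin n → ℤ, (∀ i, (∑ k, x k * Λ i (Sum.inl k)) + (∑ l, y l * Λ i (Sum.inr l)) = 0) →
      ∀ p₁ ∈ S, ∀ p₂ ∈ S, x p₁.1 + y p₁.2 = x p₂.1 + y p₂.2)
    (ι κ : Fin s → Fin n) (N : ℕ) (hN : 0 < N) (ar ac : Fin n → Fin s → ℤ)
    (har : ∀ k i, (N : ℤ) * Λ i (Sum.inl k) =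
      ∑ j, ar k j * (Λ i (Sum.inl (ι j)) - Λ i (Sum.inr (κ j))))
    (hac : ∀ l i, (N : ℤ) * Λ i (Sum.inr l) =
      ∑ j, ac l j * (Λ i (Sum.inl (ι j)) - Λ i (Sum.inr (κ j))))
    {p₁ p₂ : Fin n × Fin n} (h₁ : p₁ ∈ S) (h₂ : p₂ ∈ S)
    (hr₁ : p₁.1 ∉ Set.range ι) (hc₁ : p₁.2 ∉ Set.range κ)
    (hr₂ : p₂.1 ∉ Set.range ι) (hc₂ : p₂.2 ∉ Set.range κ) : p₁ = p₂ := by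
  classical
  -- bookkeeping: `Σ_k (Σ_j [k = φ j] c_j) f_k = Σ_j c_j f_{φ j}`, and such sums vanish at unmatched indices
  have hsum_ite : ∀ (φ : Fin s → Fin n) (c : Fin s → ℤ) (f : Fin n → ℤ),
      ∑ k, (∑ j, if k = φ j then c j else 0) * f k = ∑ j, c j * f (φ j) := by
    intro φ c f
    simp_rw [Finset.sum_mul, ite_mul, zero_mul]
    rw [Finset.sum_comm]
    refine Finset.sum_congr rfl fun j _ => ?_
    rw [Finset.sum_ite_eq' Finset.univ (φ j) (fun k => c j * f k), if_pos (Finset.mem_univ _)]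
  have hval_free : ∀ (φ : Fin s → Fin n) (c : Fin s → ℤ) (x : Fin n), x ∉ Set.range φ →
      (∑ j, if x = φ j then c j else 0) = 0 := by
    intro φ c x hx
    refine Finset.sum_eq_zero fun j _ => ?_
    rw [if_neg]
    exact fun h => hx ⟨j, h.symm⟩
  have hδ : ∀ (u : Fin n) (f : Fin n → ℤ), ∑ k, (if k = u then (N : ℤ) else 0) * f k = N * f u := by
    intro u f
    simp_rw [ite_mul, zero_mul]
    rw [Finset.sum_ite_eq' Finset.univ u (fun k => (N : ℤ) * f k), if_pos (Finset.mem_univ _)]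
  have hN0 : (N : ℤ) ≠ 0 := by exact_mod_cast hN.ne'
  -- rows
  have hrows : p₁.1 = p₂.1 := by
    obtain ⟨u, v⟩ := p₁
    have key := hSI
      (fun k => (if k = u then (N : ℤ) else 0) - ∑ j, if k = ι j then ar u j else 0)
      (fun l => ∑ j, if l = κ j then ar u j else 0) (fun i => by
        simp only [sub_mul, Finset.sum_sub_distrib, hsum_ite, hδ]
        rw [har u i]
        simp only [mul_sub, Finset.sum_sub_distrib]
        ring) (u, v) h₁ p₂ h₂
    simp only [hval_free ι _ _ hr₁, hval_free ι _ _ hr₂, hval_free κ _ _ hc₁, hval_free κ _ _ hc₂,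
      if_true, sub_zero, add_zero] at key
    by_contra hne
    rw [if_neg (Ne.symm hne)] at key
    exact hN0 key
  -- columns
  have hcols : p₁.2 = p₂.2 := by
    obtain ⟨u, v⟩ := p₁
    have key := hSI
      (fun k => -∑ j, if k = ι j then ac v j else 0)
      (fun l => (if l = v then (N : ℤ) else 0) + ∑ j, if l = κ j then ac v j else 0) (fun i => by
        simp only [neg_mul, add_mul, Finset.sum_neg_distrib, Finset.sum_add_distrib, hsum_ite, hδ]
        rw [hac v i]
        simp only [mul_sub, Finset.sum_sub_distrib]
        ring) (u, v) h₁ p₂ h₂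
    simp only [hval_free ι _ _ hr₁, hval_free ι _ _ hr₂, hval_free κ _ _ hc₁, hval_free κ _ _ hc₂,
      if_true, neg_zero, zero_add, add_zero] at key
    by_contra hne
    rw [if_neg (Ne.symm hne)] at key
    exact hN0 key
  exact Prod.ext hrows hcols

/-! ### Re-matching one pair of an injective partial matching -/

/-- Replacing one value of an injection by a value outside its range keeps it injective. [folklore] -/
theorem update_injective_of_not_mem_range {s n : ℕ} (φ : Fin s ↪ Fin n) (j₀ : Fin s) {x : Fin n}
    (hx : x ∉ Set.range φ) : Function.Injective (Function.update (⇑φ) j₀ x) := by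
  intro t₁ t₂ h
  by_cases h₁ : t₁ = j₀
  · by_cases h₂ : t₂ = j₀
    · rw [h₁, h₂]
    · subst h₁
      rw [Function.update_self, Function.update_of_ne h₂] at h
      exact absurd ⟨t₂, h.symm⟩ hx
  · by_cases h₂ : t₂ = j₀
    · subst h₂
      rw [Function.update_self, Function.update_of_ne h₁] at h
      exact absurd ⟨t₁, h⟩ hx
    · rw [Function.update_of_ne h₁, Function.update_of_ne h₂] at h
      exact φ.injective h

/-- After re-matching pair `j₀` elsewhere, its old value is unmatched. [folklore] -/
theorem self_not_mem_range_update {s n : ℕ} (φ : Fin s ↪ Fin n) (j₀ : Fin s) {x : Fin n}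
    (hx : x ∉ Set.range φ) : φ j₀ ∉ Set.range (Function.update (⇑φ) j₀ x) := by
  rintro ⟨t, ht⟩
  by_cases h : t = j₀
  · subst h
    rw [Function.update_self] at ht
    exact hx ⟨t, ht.symm⟩
  · rw [Function.update_of_ne h] at ht
    exact h (φ.injective ht)

/-- An unmatched index other than the new value stays unmatched after re-matching. [folklore] -/
theorem not_mem_range_update {s n : ℕ} (φ : Fin s → Fin n) (j₀ : Fin s) {x y : Fin n}
    (hy : y ∉ Set.range φ) (hyx : y ≠ x) : y ∉ Set.range (Function.update φ j₀ x) := by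
  rintro ⟨t, ht⟩
  by_cases h : t = j₀
  · subst h
    rw [Function.update_self] at ht
    exact hyx ht.symm
  · rw [Function.update_of_ne h] at ht
    exact hy ⟨t, ht⟩

/-! ### Coefficient comparison -/

/-- If `u − v` lies in the span of the matched differences OTHER than `j₀` (independent family `D`), the
`j₀`-coefficients of the expansions of `N u` and `N v` agree. [folklore] -/
theorem coeff_eq_of_sub_mem_span_ne {V : Type*} [AddCommGroup V] [Module ℚ V] {s : ℕ} {D : Fin s → V}
    (hw : LinearIndependent ℚ D) (j₀ : Fin s) (N : ℕ) {u v : V} {cu cv : Fin s → ℤ}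
    (hu : (N : ℚ) • u = ∑ j, (cu j : ℚ) • D j) (hv : (N : ℚ) • v = ∑ j, (cv j : ℚ) • D j)
    (h : u - v ∈ Submodule.span ℚ (D '' {j | j ≠ j₀})) : cu j₀ = cv j₀ := by
  obtain ⟨c, hc, hcuv⟩ := exists_coeffs_of_mem_span_ne D j₀ h
  have key := coord_relation hw j₀ (N : ℚ) (t := 0) hu hv hc (by rw [zero_smul, add_zero]; exact hcuv)
  have : ((cu j₀ : ℤ) : ℚ) = cv j₀ := by linarith
  exact_mod_cast this

/-! ### The two easy exits, in the output format of the final matching -/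

/-- **Diagonal support or one free support position.**  Let `(ι, κ)` be an independent partial matching of size
`s ≤ r` that is MAXIMUM (`hmax`), with `s + 3 ≤ n`, and let `p ∈ S` be either free (row and column unmatched) or a
diagonal pair `(ι j, κ j)`.  Then the final-matching data exist: in the free case `p` is added as one extra pair
(`t = s + 1`; no free support remains by `free_support_unique`; the pin is the new diagonal pair), in the diagonal
case — when no free support exists — the matching itself with pin `p` (otherwise the free case applies).
[folklore] -/
theorem concl_of_free_or_diag {n r s : ℕ} (Λ : Fin r → (Fin n ⊕ Fin n) → ℤ)
    (hrow : ∀ i, (∑ k, Λ i (Sum.inl k)) = 0) (S : Finset (Fin n × Fin n))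
    (hSI : ∀ x y : Fin n → ℤ, (∀ i, (∑ k, x k * Λ i (Sum.inl k)) + (∑ l, y l * Λ i (Sum.inr l)) = 0) →
      ∀ p₁ ∈ S, ∀ p₂ ∈ S, x p₁.1 + y p₁.2 = x p₂.1 + y p₂.2)
    (ι κ : Fin s ↪ Fin n) (hs : s ≤ r) (hn : s + 3 ≤ n)
    (hw : LinearIndependent ℚ (fun (t : Fin s) (i : Fin r) =>
      ((Λ i (Sum.inl (ι t)) : ℚ) - (Λ i (Sum.inr (κ t)) : ℚ))))
    (hmax : ∀ ι' κ' : Fin (s + 1) ↪ Fin n, ¬ LinearIndependent ℚ (fun (t : Fin (s + 1)) (i : Fin r) =>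
      ((Λ i (Sum.inl (ι' t)) : ℚ) - (Λ i (Sum.inr (κ' t)) : ℚ))))
    (p : Fin n × Fin n) (hp : p ∈ S)
    (hpd : (p.1 ∉ Set.range ι ∧ p.2 ∉ Set.range κ) ∨ ∃ j, p = (ι j, κ j)) :
    ∃ (t : ℕ) (ι κ : Fin t ↪ Fin n) (N : ℕ) (ar ac : Fin n → Fin t → ℤ) (p₀ : Fin n × Fin n),
      t ≤ r + 1 ∧ 0 < N ∧
      (∀ k i, (N : ℤ) * Λ i (Sum.inl k) = ∑ j, ar k j * (Λ i (Sum.inl (ι j)) - Λ i (Sum.inr (κ j)))) ∧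
      (∀ l i, (N : ℤ) * Λ i (Sum.inr l) = ∑ j, ac l j * (Λ i (Sum.inl (ι j)) - Λ i (Sum.inr (κ j)))) ∧
      (∀ p ∈ S, p.1 ∈ Set.range ι ∨ p.2 ∈ Set.range κ) ∧ p₀ ∈ S ∧
      ((∃ j, p₀ = (ι j, κ j)) ∨
       (∃ (j₀ : Fin t) (l₀ : Fin n) (α : ℤ), p₀ = (ι j₀, l₀) ∧ l₀ ∉ Set.range κ ∧
          (∀ k, k ∉ Set.range ι → ar k j₀ = α) ∧ (∀ l, l ∉ Set.range κ → l ≠ l₀ → ac l j₀ = α) ∧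
          ac l₀ j₀ = α + N) ∨
       (∃ (k₀ : Fin n) (j₀ : Fin t) (α : ℤ), p₀ = (k₀, κ j₀) ∧ k₀ ∉ Set.range ι ∧
          (∀ l, l ∉ Set.range κ → ac l j₀ = α) ∧ (∀ k, k ∉ Set.range ι → k ≠ k₀ → ar k j₀ = α) ∧
          ar k₀ j₀ + N = α) ∨
       (∃ (j₀ j₁ : Fin t) (α₀ α₁ : ℤ), j₀ ≠ j₁ ∧ p₀ = (ι j₀, κ j₁) ∧
          (∀ k, k ∉ Set.range ι → ar k j₀ = α₀) ∧ (∀ l, l ∉ Set.range κ → ac l j₀ = α₀) ∧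
          (∀ k, k ∉ Set.range ι → ar k j₁ = α₁) ∧ (∀ l, l ∉ Set.range κ → ac l j₁ = α₁))) := by
  classical
  let a : Fin n → (Fin r → ℚ) := fun k i => (Λ i (Sum.inl k) : ℚ)
  let b : Fin n → (Fin r → ℚ) := fun l i => (Λ i (Sum.inr l) : ℚ)
  have hw' : LinearIndependent ℚ (fun t => a (ι t) - b (κ t)) := hw
  have hmax' : ∀ ι' κ' : Fin (s + 1) ↪ Fin n, ¬ LinearIndependent ℚ (fun t => a (ι' t) - b (κ' t)) :=
    fun ι' κ' h => hmax ι' κ' h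
  have hspanQ : ∀ k l, a k - b l ∈ span ℚ (Set.range fun t => a (ι t) - b (κ t)) :=
    indepMatching_span a b ι κ hw' hmax' hn
  obtain ⟨N, ar, ac, hN, har, hac⟩ :=
    intExpansions_of_span Λ hrow (by omega) ι κ (fun k l => hspanQ k l)
  by_cases hfree : ∃ p₁ ∈ S, p₁.1 ∉ Set.range ι ∧ p₁.2 ∉ Set.range κ
  · -- ONE EXTRA PAIR
    obtain ⟨p₁, hp₁, hr₁, hc₁⟩ := hfree
    let ι' : Fin (s + 1) ↪ Fin n := ⟨Fin.cons p₁.1 ι, Fin.cons_injective_iff.2 ⟨hr₁, ι.injective⟩⟩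
    let κ' : Fin (s + 1) ↪ Fin n := ⟨Fin.cons p₁.2 κ, Fin.cons_injective_iff.2 ⟨hc₁, κ.injective⟩⟩
    have hι' : ∀ x, x ∈ Set.range ι' ↔ x = p₁.1 ∨ x ∈ Set.range ι := fun x => by
      show x ∈ Set.range (Fin.cons p₁.1 (⇑ι) : Fin (s + 1) → Fin n) ↔ _
      rw [Fin.range_cons]
      simp
    have hκ' : ∀ x, x ∈ Set.range κ' ↔ x = p₁.2 ∨ x ∈ Set.range κ := fun x => by
      show x ∈ Set.range (Fin.cons p₁.2 (⇑κ) : Fin (s + 1) → Fin n) ↔ _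
      rw [Fin.range_cons]
      simp
    refine ⟨s + 1, ι', κ', N, fun k => Fin.cons 0 (ar k), fun l => Fin.cons 0 (ac l), p₁, by omega, hN,
      fun k i => ?_, fun l i => ?_, fun p hp => ?_, hp₁, Or.inl ⟨0, ?_⟩⟩
    · rw [har k i, Fin.sum_univ_succ]
      simp [ι', κ']
    · rw [hac l i, Fin.sum_univ_succ]
      simp [ι', κ']
    · by_contra hcon
      push Not at hcon
      obtain ⟨hpr, hpc⟩ := hcon
      rw [hι'] at hpr
      rw [hκ'] at hpc
      push Not at hpr hpc
      have := free_support_unique Λ S hSI ι κ N hN ar ac har hac hp hp₁ hpr.2 hpc.2 hr₁ hc₁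
      exact hpr.1 (by rw [this])
    · simp [ι', κ']
  · -- NO FREE SUPPORT: the given position is a diagonal pair
    push Not at hfree
    have hnofree : ∀ p ∈ S, p.1 ∈ Set.range ι ∨ p.2 ∈ Set.range κ := fun p' hp' => by
      by_cases h : p'.1 ∈ Set.range ι
      · exact Or.inl h
      · exact Or.inr (hfree p' hp' h)
    rcases hpd with ⟨hr, hc⟩ | ⟨j, hj⟩
    · exact absurd (hfree p hp hr) hc
    · exact ⟨s, ι, κ, N, ar, ac, p, by omega, hN, har, hac, hnofree, hp, Or.inl ⟨j, hj⟩⟩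

end Summit.ValiantsHypothesis.ValiantsHypothesis.Theorems.FreeSubtorusOrbitDimensionBound.AbsorbingSacrifice
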